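import Literature.Topology.FourManifolds.SurfaceGroupGeneratorImages
import Mathlib.Algebra.BigOperators.Group.List.Lemmas
import HarnessLib

/-!
# The cyclic shift automorphisms of the surface group `S_g`

Topic `Literature/Topology/FourManifolds`; companion of `SurfaceGroupGeneratorImages.lean`
(automorphisms of `S_g = ⟨a₀, b₀, …, a_{g-1}, b_{g-1} ∣ ∏ᵢ [aᵢ, bᵢ]⟩` from generator images), written for
the Dehn–Nielsen–Baer seat (`DehnNielsenBaerSurface.lean`): the rotation `ρ_j` of the flower surface `Z_g` by
`2πj/g` permutes the handles of the melon marking cyclically (`FlowerMarkingValues.lean`,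
`mapOfEq_rotS_secSGenClass`), so on `S_g` it is **the cyclic shift `a_k ↦ a_{k+j}`, `b_k ↦ b_{k+j}`
(indices mod `g`)** — an automorphism because the shifted relator `∏_k [a_{k+j}, b_{k+j}]` is a
rotation of the list of commutators, hence a conjugate of the relator (here: a rotation of a list
with trivial product has trivial product, `List.prod_rotate_eq_one_of_prod_eq_one`).

* `SurfaceGroup.cycShiftGens g j` — the generator images; `range_map_add_mod` — the list
  `[(k + j) % g]_{k<g}` is the rotation by `j` of `[0, …, g-1]`; `prod_relFactor_cycShiftGens` — they
  kill the relator;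
* `SurfaceGroup.cycShiftEquiv g j : S_g ≃* S_g` with `cycShiftEquiv_of`, `cycShiftEquiv_symm_of`
  (the inverse is the shift by `gj - j ≡ -j (mod g)`).

Everything is proved; no named facts (D-0026).

## References

* H. Zieschang, E. Vogt, H.-D. Coldewey, *Surfaces and Planar Discontinuous Groups*, LNM 835 (1980),
  §3.2 (automorphisms of the canonical presentation induced by symmetries of the canonical polygon).
  [ZieschangVogtColdewey1980]
* B. Farb, D. Margalit, *A primer on mapping class groups* (2012), Thm. 8.1. [FarbMargalit2012]
-/

noncomputable section

namespace Literature.Topology.FourManifolds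

namespace SurfaceGroup

variable {g : ℕ}

/-! ### §1 The shifted generator images -/

/-- The index shift `k ↦ (k + j) mod g` on `Fin g`. [folklore] -/
def shiftFin (j : ℕ) (k : Fin g) : Fin g := ⟨(k + j) % g, Nat.mod_lt _ k.pos⟩

/-- `shiftFin j k` as a natural number. [folklore] -/
@[simp] theorem val_shiftFin (j : ℕ) (k : Fin g) : (shiftFin j k : ℕ) = (k + j) % g := rfl

/-- **The generator images of the cyclic shift**: `a_k ↦ a_{k+j}`, `b_k ↦ b_{k+j}`. [folklore] -/
def cycShiftGens (g j : ℕ) (p : surfaceGen g) : SurfaceGroup g :=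
  PresentedGroup.of (shiftFin j p.1, p.2)

/-- The list `[(k + j) % g]_{k < g}` is the rotation by `j` of `[0, …, g - 1]`. [folklore] -/
theorem range_map_add_mod (g j : ℕ) :
    (List.range g).map (fun k => (k + j) % g) = (List.range g).rotate j := by
  refine List.ext_getElem (by simp) fun i h₁ h₂ => ?_
  simp [List.getElem_rotate]

/-- The relator factor of the shifted images is the shifted relator factor. [folklore] -/
theorem relFactor_cycShiftGens (g j k : ℕ) :
    relFactor (cycShiftGens g j) k =
      relFactor (fun p => (PresentedGroup.of p : SurfaceGroup g)) (if k < g then (k + j) % g else g) := by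
  by_cases hk : k < g
  · have hg : 0 < g := lt_of_le_of_lt (Nat.zero_le k) hk
    rw [if_pos hk, relFactor, dif_pos hk, relFactor, dif_pos (Nat.mod_lt _ hg)]
    rfl
  · rw [if_neg hk, relFactor, dif_neg hk, relFactor, dif_neg (lt_irrefl g)]

/-- **The shifted images kill the relator**: the list of their commutators is the rotation by `j`
of the list of the standard commutators, whose product is `1`. [folklore] -/
theorem prod_relFactor_cycShiftGens (g j : ℕ) :
    ((List.range g).map (relFactor (cycShiftGens g j))).prod = 1 := by
  have h : (List.range g).map (relFactor (cycShiftGens g j)) =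
      ((List.range g).map (relFactor fun p => (PresentedGroup.of p : SurfaceGroup g))).rotate j := by
    rw [← List.map_rotate, ← range_map_add_mod, List.map_map]
    refine List.map_congr_left fun k hk => ?_
    rw [List.mem_range] at hk
    rw [Function.comp_apply, relFactor_cycShiftGens, if_pos hk]
  rw [h]
  exact List.prod_rotate_eq_one_of_prod_eq_one prod_relFactor_of j

/-! ### §2 The cyclic shift automorphism -/

/-- `k + j + (gj - j) = k + gj`. [folklore] -/
theorem add_add_mul_sub (g j k : ℕ) (hg : 0 < g) : k + j + (g * j - j) = k + g * j := by
  have hj : j ≤ g * j := Nat.le_mul_of_pos_left j hg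
  omega

/-- Shifting by `j` and then by `gj - j` is the identity on indices. [folklore] -/
theorem shiftFin_shiftFin_inv (j : ℕ) (k : Fin g) : shiftFin (g * j - j) (shiftFin j k) = k := by
  apply Fin.ext
  rw [val_shiftFin, val_shiftFin, Nat.mod_add_mod, add_add_mul_sub g j k k.pos,
    Nat.add_mul_mod_self_left, Nat.mod_eq_of_lt k.2]

/-- Shifting by `gj - j` and then by `j` is the identity on indices. [folklore] -/
theorem shiftFin_inv_shiftFin (j : ℕ) (k : Fin g) : shiftFin j (shiftFin (g * j - j) k) = k := by
  apply Fin.ext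
  have h : (k : ℕ) + (g * j - j) + j = k + g * j := by
    have hj : j ≤ g * j := Nat.le_mul_of_pos_left j k.pos
    omega
  rw [val_shiftFin, val_shiftFin, Nat.mod_add_mod, h, Nat.add_mul_mod_self_left, Nat.mod_eq_of_lt k.2]

/-- **The cyclic shift automorphism `a_k ↦ a_{k+j}`, `b_k ↦ b_{k+j}` of `S_g`** (indices mod `g`;
inverse the shift by `gj - j ≡ -j`). [cite: ZieschangVogtColdewey1980, §3.2] -/
def cycShiftEquiv (g j : ℕ) : SurfaceGroup g ≃* SurfaceGroup g :=
  equivOfGens (cycShiftGens g j) (cycShiftGens g (g * j - j)) (prod_relFactor_cycShiftGens g j)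
    (prod_relFactor_cycShiftGens g (g * j - j))
    (fun p => by
      rw [cycShiftGens, homOfGens_of, cycShiftGens, shiftFin_shiftFin_inv])
    (fun p => by
      rw [cycShiftGens, homOfGens_of, cycShiftGens, shiftFin_inv_shiftFin])

/-- `cycShiftEquiv` on a generator. [folklore] -/
@[simp] theorem cycShiftEquiv_of (g j : ℕ) (p : surfaceGen g) :
    cycShiftEquiv g j (PresentedGroup.of p) = PresentedGroup.of (shiftFin j p.1, p.2) :=
  equivOfGens_of _ _ _ _ _ _ p

/-- The inverse of `cycShiftEquiv` on a generator. [folklore] -/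
@[simp] theorem cycShiftEquiv_symm_of (g j : ℕ) (p : surfaceGen g) :
    (cycShiftEquiv g j).symm (PresentedGroup.of p) =
      PresentedGroup.of (shiftFin (g * j - j) p.1, p.2) :=
  equivOfGens_symm_of _ _ _ _ _ _ p

/-- `cycShiftEquiv` on `a_k`. [folklore] -/
theorem cycShiftEquiv_a (g j : ℕ) (k : Fin g) : cycShiftEquiv g j (a k) = a (shiftFin j k) :=
  cycShiftEquiv_of g j (k, false)

/-- `cycShiftEquiv` on `b_k`. [folklore] -/
theorem cycShiftEquiv_b (g j : ℕ) (k : Fin g) : cycShiftEquiv g j (b k) = b (shiftFin j k) :=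
  cycShiftEquiv_of g j (k, true)

end SurfaceGroup

end Literature.Topology.FourManifolds

end
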